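import Summits.QuantumFields.BalabanUV.Beta.GAN24.CapacitanceRateScaled
import Summits.QuantumFields.BalabanUV.Beta.GAN24.CombesThomas

/-!
# `BalabanUV.Beta.GAN24.FibreRateMM` — binder row G-an2-4 / (CONV-C), road P1-fibre, leaf **P1-L11** `FibreRate` (Part B): the MULTIPLIER–MULTIPLIER
# leg of the one-step rate at `d = 3`, CLOSED from the capacitance half alone — `‖sm_{j+1}²·φ′ − sm_j²·φ‖ ≤ (crPP 4·|q|⁴/Lc^{10})·(Lc⁻²)^j`

NOT IN PRINT; OUR PROOF ATTEMPT.  HONEST FRAMING (cell contract, verbatim): «discharging `BetaPertH` makes Bałaban's UV stability UNCONDITIONAL — a real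
constructive-QFT result; it is NOT the continuum limit and NOT the Clay problem.»  HONEST DEPENDENCY (verbatim): «continuum YM on T⁴ ⇐ BetaPertH ∧ nine spine
estimates (0/9 proved); BetaPertH ⇐ (D1) ∧ (D4) ∧ CAP+tail; G-an2-4 gates asym, D1 and NE2/3/4.»  [folklore] bookkeeping: T00's `phiSol` at zero force
and unit constraint source is a matrix entry of `(cap N p)⁻¹`; the adopted multiplier unit `CombesThomas.smStep 3 Lc j = Lc^{4j}` (BY NAME, not re-typed —
TRIGGER-P1 c2) squared IS the capacitance scaling `N^{D+4} = (Lc^{j+1})^8` up to `Lc^{−8}`; then `CapacitanceRateScaled.scaled_cap_inv_inl_inl_rate`.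
No cited fact, no wall binder, no `def`, no `def … : Prop` hypothesis.  NOT summit progress: this is ONE of the four leg hypotheses (`hmm`) of
`ClosedFormRateOfParts.norm_kFibClosed_succ_sub_le_of_parts` for row L11 = shape (I2′); it discharges NOTHING of (CONV-C)'s K-slot by itself; 0 wall
binders instantiated; NOT `BetaPertH`, NOT continuum, NOT Clay.

## What is proved
* `phiSol_zero_eVec : phiSol N p 0 (eVec l) κ = (cap N p)⁻¹ (inl κ) (inl l)` (every `D`, `N`, complex `p`: `r_φ = e_l`, `r_c = 0`);
* `smStep_three_sq : smStep 3 Lc j · smStep 3 Lc j = (Lc^{j+1})^8/Lc^8`, `sm_sq_mul_phiSol_eq` (the scaled mm response is `Lc^{−8}·N^8·(cap N p)⁻¹_{κl}`);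
* **`mm_rate`**: for every `Lc ≥ 1`, `j`, `q ∈ [−π, π]^4 ∖ {0}`, `κ, l`:
  `‖(smStep 3 Lc (j+1))²·phiSol (Lc^{j+2}) (ofRealVec q) 0 (eVec l) κ − (smStep 3 Lc j)²·phiSol (Lc^{j+1}) (ofRealVec q) 0 (eVec l) κ‖
     ≤ crPP 4 · momSq q² / Lc^{10} · (Lc⁻²)^j` — geometric rate `θ = Lc⁻²` with a `q`-dependent constant `≤ crPP 4·(4π²)²/Lc^{10}` on the zone.

Unit `b2b-balaban-gan24-formalise-leaf-20` (G-an2-4 formalisation swarm, leaf prover 20), 2026-08-20.  Value = kernel assembly leaf toward the K-slot route P1,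
NOT summit progress.
-/

noncomputable section

open Complex Finset
open scoped BigOperators Real

namespace Summit.QuantumFields.BalabanUV.Beta.GAN24.FibreRateMM

open Literature.MathematicalPhysics.QuantumFieldTheory.Balaban1983to89.B4Strip (ofRealVec)
open Literature.MathematicalPhysics.QuantumFieldTheory.King1986 (momSq)

/-! ## The multiplier–multiplier leg of row L11 at `d = 3`: rate `θ^j`, `θ = Lc⁻²`, from the capacitance half ALONE -/

section MM
open CapacitanceRateScaled (crPP scaled_cap_inv_inl_inl_rate)
open CapacitanceEndpointBlocks (cPP)
open CapacitanceEndpoint (norm_cap_inv_inl_inl_le)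
open AliasObjects (cap capSol phiSol srcPhi srcC eVec piPerp)
open CombesThomas (smStep)

variable {D : ℕ}

/-- [folklore] **THE mm RESPONSE IS A MATRIX ENTRY**: with no force (`f̂ = 0`) and the unit constraint source `ĉ = e_l`, T00's `r_φ = e_l`, `r_c = 0`, so
`phiSol N p 0 (eVec l) κ = (cap N p)⁻¹ (inl κ) (inl l)` (every complex `p`, every `N`). -/
theorem phiSol_zero_eVec (N : ℕ) [NeZero N] (p : Fin D → ℂ) (l κ : Fin D) :
    phiSol N p 0 (eVec l) κ = (cap N p)⁻¹ (Sum.inl κ) (Sum.inl l) := by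
  have hφ : srcPhi N p 0 (eVec l) = eVec l := by
    funext κ'
    simp [AliasObjects.srcPhi, AliasObjects.piPerp, FibreBlockSolve.dot]
  have hc : srcC N p 0 = 0 := by
    simp [AliasObjects.srcC, FibreBlockSolve.dot]
  unfold AliasObjects.phiSol AliasObjects.capSol
  rw [hφ, hc]
  simp [Matrix.mulVec, dotProduct, Fintype.sum_sum_type, AliasObjects.eVec]

variable {Lc : ℕ} [NeZero Lc]

omit [NeZero Lc] in
/-- [folklore] **THE UNITS MATCH AT `d = 3`**: `smStep 3 Lc j² = (Lc^{j+1})^8 / Lc^8` — the multiplier-leg unit squared IS the capacitance scaling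
`N^{D+4}`, `D = 4`, up to the `j`-independent factor `Lc^{−8}` (SKELETON-P1 S1c; TRIGGER-P1 c2: `smStep` BY NAME, not re-typed). -/
theorem smStep_three_sq (hLc : (Lc : ℝ) ≠ 0) (j : ℕ) :
    smStep 3 Lc j * smStep 3 Lc j = ((Lc : ℝ) ^ (j + 1)) ^ (3 + 1 + 4) / (Lc : ℝ) ^ 8 := by
  unfold CombesThomas.smStep
  rw [eq_div_iff (pow_ne_zero _ hLc), ← pow_add, ← pow_mul, ← pow_add]
  congr 1
  ring

/-- [folklore] The scaled mm response: `sm_j²·phiSol_{Lc^{j+1}}(0, e_l)_κ = Lc^{−8}·(N^8·(cap N p)⁻¹ (inl κ) (inl l))`, `N = Lc^{j+1}`. -/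
theorem sm_sq_mul_phiSol_eq (j : ℕ) (p : Fin (3 + 1) → ℂ) (l κ : Fin (3 + 1)) :
    ((smStep 3 Lc j * smStep 3 Lc j : ℝ) : ℂ) * phiSol (Lc ^ (j + 1)) p 0 (eVec l) κ
      = ((Lc : ℂ) ^ 8)⁻¹ * (((Lc ^ (j + 1) : ℕ) : ℂ) ^ (3 + 1 + 4) * (cap (Lc ^ (j + 1)) p)⁻¹ (Sum.inl κ) (Sum.inl l)) := by
  have hLc : (Lc : ℝ) ≠ 0 := Nat.cast_ne_zero.2 (NeZero.ne Lc)
  have hLcC : (Lc : ℂ) ^ 8 ≠ 0 := pow_ne_zero _ (Nat.cast_ne_zero.2 (NeZero.ne Lc))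
  rw [phiSol_zero_eVec, smStep_three_sq hLc]
  push_cast
  field_simp

/-- **ROW L11, mm LEG — DONE FROM THE CAPACITANCE HALF** [folklore]: at `d = 3`, for every `Lc ≥ 1`, every step `j`, every
`q ∈ [−π, π]^4 ∖ {0}` and all multiplier legs `κ, l`:
`‖sm_{j+1}²·phiSol_{Lc^{j+2}}(0, e_l)_κ − sm_j²·phiSol_{Lc^{j+1}}(0, e_l)_κ‖ ≤ (crPP 4·|q|⁴/Lc^{10}) · (Lc⁻²)^j`
— the hypothesis `hmm` of `ClosedFormRateOfParts.norm_kFibClosed_succ_sub_le_of_parts` with `C_mm = crPP 4·|q|⁴·Lc^{−10}·θ^j`, `θ = Lc⁻²`. -/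
theorem mm_rate (j : ℕ) {q : Fin (3 + 1) → ℝ} (hq : ∀ i, |q i| ≤ π) (hq0 : q ≠ 0) (κ l : Fin (3 + 1)) :
    ‖((smStep 3 Lc (j + 1) * smStep 3 Lc (j + 1) : ℝ) : ℂ) * phiSol (Lc ^ (j + 2)) (ofRealVec q) 0 (eVec l) κ
        - ((smStep 3 Lc j * smStep 3 Lc j : ℝ) : ℂ) * phiSol (Lc ^ (j + 1)) (ofRealVec q) 0 (eVec l) κ‖
      ≤ crPP (3 + 1) * momSq q ^ 2 / (Lc : ℝ) ^ 10 * (((Lc : ℝ) ^ 2)⁻¹) ^ j := by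
  have hLc1 : 1 ≤ Lc := Nat.one_le_iff_ne_zero.2 (NeZero.ne Lc)
  have hLc0 : (0 : ℝ) < Lc := by exact_mod_cast hLc1
  have hN : 1 ≤ Lc ^ (j + 1) := Nat.one_le_pow _ _ hLc1
  have hNN' : Lc ^ (j + 1) ≤ Lc ^ (j + 2) := Nat.pow_le_pow_right hLc1 (by omega)
  have h := scaled_cap_inv_inl_inl_rate (D := 3 + 1) hN hNN' hq hq0 κ l
  rw [sm_sq_mul_phiSol_eq (j + 1) (ofRealVec q) l κ, sm_sq_mul_phiSol_eq j (ofRealVec q) l κ, ← mul_sub, norm_mul, norm_inv, norm_pow,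
    Complex.norm_natCast]
  have e : ((Lc : ℝ) ^ 8)⁻¹ * (crPP (3 + 1) * momSq q ^ 2 / ((Lc ^ (j + 1) : ℕ) : ℝ) ^ 2)
      = crPP (3 + 1) * momSq q ^ 2 / (Lc : ℝ) ^ 10 * (((Lc : ℝ) ^ 2)⁻¹) ^ j := by
    have hL2 : (((Lc : ℝ) ^ 2)⁻¹) ^ j = ((Lc : ℝ) ^ (2 * j))⁻¹ := by rw [inv_pow, ← pow_mul]
    push_cast
    rw [hL2]
    field_simp
    ring
  rw [← e]
  exact mul_le_mul_of_nonneg_left h (inv_nonneg.2 (pow_nonneg hLc0.le 8))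

end MM

end Summit.QuantumFields.BalabanUV.Beta.GAN24.FibreRateMM

end
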